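import Mathlib
import Summits.Ventures.HodgeRepro.Tier4.Line4.MainTermSplit
import Summits.Ventures.HodgeRepro.Tier4.Line4.SuppMeasureSplit
import Summits.Ventures.HodgeRepro.Tier4.Line4.SuppMeasureTranslate
import Summits.Ventures.HodgeRepro.Tier4.Line4.LevelPhaseAtP

/-!
# Tier4/Line4/FinNVPhase — C-L4-FINNV-GLUE, the pieces: the unit is domain-independent, the level indicators at the
pure arguments are the indicators of the split support sets, and THE PHASE-INTEGRAL BOUND `‖I_S(N) − vol_S(N)‖ ≤ ε · vol_S(N)`

Blind re-derivation cell `pub-hodge-repro`, Tier 4 «prove the step» (README §9–§10), LINE L4, seat t4-L4-x2 (g0, the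
extra prover seat; plan-4 g6's cut S15792 + the R-DZF-OF-RECORD correction S15796; statement S15810).  Tree path
`lean/Summits/Ventures/HodgeRepro/Tier4/Line4/FinNVPhase.lean`.  Imports x2's MainTermSplit (`localFactorAt`,
`awayOrbital`, `ofPlacesPart_pureArg`, `offPlacesPart_pureArg`), L2-p1's SuppMeasureSplit (`suppSetAt`, `suppSetAway`,
`suppMeasureAt`, `isClosed_suppSetAt`), L2-p3's SuppMeasureTranslate (`measure_fibreSet_centreFin_smul`) and L4-p1's
LevelPhaseAtP (`pPhase`).  Mathlib-level; no literature.

* `suppMeasure_eq_of_isFundamentalDomain` — the support measure is the same for every `Z(k)`-fundamental domain of `T_f`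
  (the fibre function is `Z(k)`-invariant, `IsFundamentalDomain.setLIntegral_eq`): S15796's «one lemma».
* `levelDCAt_pureArg_eq_indicator` / `levelDCAway_pureArg_eq_indicator` — the `S`-factor / away factor of the level
  indicator at the pure argument `x⁻¹ γ₀,f x′` / `y⁻¹ γ₀,f y′` is the indicator of `suppSetAt` / `suppSetAway` at `γ = γ₀`.
* `exists_mem_suppSetAway_of_awayOrbital_ne_zero` — `awayOrbital ≠ 0` forces a point of `suppSetAway(1)` over `DZ^{(S)}`.
* `continuous_phaseAt`, `norm_phaseAt`, `localFactorAt_eq_setIntegral` — `I_S(N)` is ONE integral of the `S`-part phase `χ(x) conj χ′(x′)` over the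
  `DZ_S`-cut `S`-support set against `ν_S ⊗ ν′_S` (Fubini on a bounded integrand of finite support measure).
* **`norm_localFactorAt_sub_le`**, `norm_localFactorAt_ge` — the phase-integral bound: `‖phase − 1‖ ≤ ε` on the cut support
  set gives `‖I_S(N) − vol_S(N)‖ ≤ ε · vol_S(N)`, hence `(1 − ε) · vol_S(N) ≤ ‖I_S(N)‖`.
* `pPhase_eq_of_ofPlacesPart` — the `S`-part phase of a pair whose `S`-parts are `(t, t′)` is `χ(t) conj χ′(t′)`.

Nothing here says anything about the status of the Hodge conjecture for CM abelian varieties, which is NOT proved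
(HC_CM is NOT proved by anyone in this repository).
-/

set_option autoImplicit false

noncomputable section

namespace Summit.Ventures.HodgeRepro.Tier4.Line4

open Summit.Ventures.HodgeRepro.Tier4 Summit.Ventures.HodgeRepro.Tier4.Common
  Summit.Ventures.HodgeRepro.Tier4.Line1 NumberField IsDedekindDomain MeasureTheory

open scoped NumberField ComplexConjugate NNReal ENNReal

/-! ## 1. The unit does not depend on the `Z(k)`-fundamental domain -/

section Unit

variable {k : Type} [Field k] [NumberField k] (W : PlaneData k) [MeasurableSpace (GA W)] [BorelSpace (GA W)]
  (νf : Measure (torusFin W)) (νf' : Measure (torusFin' W)) (γ₀ : GA W)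

/-- **The support measure is the same for every `Z(k)`-fundamental domain of `T_f`**: `suppMeasure = ∫⁻_{DZ_f} ν′_f(fibre)`
with a `Z(k)`-invariant fibre function (L2-p3's `measure_fibreSet_centreFin_smul`), so the two domains give the same
integral (`IsFundamentalDomain.setLIntegral_eq`). -/
theorem suppMeasure_eq_of_isFundamentalDomain [νf.IsHaarMeasure] [νf'.IsHaarMeasure] {N : ℕ} (hN : N ≠ 0)
    {DZf DZf' : Set (torusFin W)} (hDZf : MeasurableSet DZf) (hDZf' : MeasurableSet DZf')
    (hfd : IsFundamentalDomain (centreFin W) DZf νf) (hfd' : IsFundamentalDomain (centreFin W) DZf' νf)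
    (γ : GA W) :
    suppMeasure W νf νf' γ₀ DZf N γ = suppMeasure W νf νf' γ₀ DZf' N γ := by
  haveI : BorelSpace (torusT W) := Subtype.borelSpace _
  haveI : BorelSpace (torusFin W) := Subtype.borelSpace _
  haveI : Countable (centreFin W) := countable_centreFin W
  haveI : SMulInvariantMeasure (torusFin W) (torusFin W) νf := ⟨fun c _ _ => measure_preimage_mul νf c _⟩
  haveI : SMulInvariantMeasure (centreFin W) (torusFin W) νf := Subgroup.smulInvariantMeasure _
  haveI : MeasurableConstSMul (torusFin W) (torusFin W) := ⟨fun c => measurable_const_mul c⟩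
  haveI : MeasurableConstSMul (centreFin W) (torusFin W) := ⟨fun c => measurable_const_mul (c : torusFin W)⟩
  rw [suppMeasure_eq_lintegral_fibre W νf νf' γ₀ DZf N γ hN hDZf,
    suppMeasure_eq_lintegral_fibre W νf νf' γ₀ DZf' N γ hN hDZf']
  exact hfd.setLIntegral_eq hfd' (fun b => νf' (fibreSet W γ₀ N γ b)) (measure_fibreSet_centreFin_smul W νf' γ₀ N γ)

end Unit

/-! ## 2. The two level indicators at the pure arguments are the indicators of `suppSetAt` / `suppSetAway` -/

section Indicator

variable {k : Type} [Field k] [NumberField k] (W : PlaneData k) (S : Set (HeightOneSpectrum (𝓞 k))) (γ₀ : GA W) (N : ℕ)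

/-- `levelDCAt` at the pure argument `x⁻¹ γ₀,f x′` is the indicator of `suppSetAt γ₀ N γ₀` at `(x, x′)`. -/
theorem levelDCAt_pureArg_eq_indicator (x : torusFinAt W S) (x' : torusFinAt' W S) :
    levelDCAt W S γ₀ N
        ((((x : torusFin W) : torusT W) : GA W)⁻¹ * GA.ofFinPart W γ₀ * (((x' : torusFin' W) : torusT' W) : GA W)) =
      (suppSetAt W S γ₀ N γ₀).indicator (fun _ => (1 : ℂ)) (x, x') := by
  unfold levelDCAt
  rw [ofPlacesPart_pureArg]
  by_cases h : (x, x') ∈ suppSetAt W S γ₀ N γ₀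
  · rw [Set.indicator_of_mem h, Set.indicator_of_mem
      (show (((x : torusFin W) : torusT W) : GA W)⁻¹ * GA.ofPlacesPart W S (GA.ofFinPart W γ₀) *
        (((x' : torusFin' W) : torusT' W) : GA W) ∈ levelDoubleCoset W N (GA.ofPlacesPart W S (GA.ofFinPart W γ₀))
        from h)]
  · rw [Set.indicator_of_notMem h, Set.indicator_of_notMem
      (show (((x : torusFin W) : torusT W) : GA W)⁻¹ * GA.ofPlacesPart W S (GA.ofFinPart W γ₀) *
        (((x' : torusFin' W) : torusT' W) : GA W) ∉ levelDoubleCoset W N (GA.ofPlacesPart W S (GA.ofFinPart W γ₀))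
        from h)]

/-- `levelDCAway` at the pure argument `y⁻¹ γ₀,f y′` is the indicator of `suppSetAway γ₀ N γ₀` at `(y, y′)`. -/
theorem levelDCAway_pureArg_eq_indicator (y : torusFinAway W S) (y' : torusFinAway' W S) :
    levelDCAway W S γ₀ N
        ((((y : torusFin W) : torusT W) : GA W)⁻¹ * GA.ofFinPart W γ₀ * (((y' : torusFin' W) : torusT' W) : GA W)) =
      (suppSetAway W S γ₀ N γ₀).indicator (fun _ => (1 : ℂ)) (y, y') := by
  unfold levelDCAway
  rw [offPlacesPart_pureArg]
  by_cases h : (y, y') ∈ suppSetAway W S γ₀ N γ₀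
  · rw [Set.indicator_of_mem h, Set.indicator_of_mem
      (show (((y : torusFin W) : torusT W) : GA W)⁻¹ * GA.offPlacesPart W S (GA.ofFinPart W γ₀) *
        (((y' : torusFin' W) : torusT' W) : GA W) ∈ levelDoubleCoset W N (GA.offPlacesPart W S (GA.ofFinPart W γ₀))
        from h)]
  · rw [Set.indicator_of_notMem h, Set.indicator_of_notMem
      (show (((y : torusFin W) : torusT W) : GA W)⁻¹ * GA.offPlacesPart W S (GA.ofFinPart W γ₀) *
        (((y' : torusFin' W) : torusT' W) : GA W) ∉ levelDoubleCoset W N (GA.offPlacesPart W S (GA.ofFinPart W γ₀))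
        from h)]

end Indicator

/-! ## 3. The away support set is non-empty when the away orbital integral is non-zero -/

section Away

variable {k : Type} [Field k] [NumberField k] (W : PlaneData k) (S : Set (HeightOneSpectrum (𝓞 k)))
  [MeasurableSpace (GA W)] (R : RTFData W) (γ₀ : GA W)

/-- **`awayOrbital ≠ 0` forces a point of `suppSetAway(1)` over `DZ^{(S)}`**: otherwise every inner integrand vanishes
on `DZ^{(S)}` and the away orbital integral is `0`. -/
theorem exists_mem_suppSetAway_of_awayOrbital_ne_zero (νA : Measure (torusFinAway W S))
    (νA' : Measure (torusFinAway' W S)) (DZA : Set (torusFinAway W S))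
    (haway : awayOrbital W S R γ₀ νA νA' DZA ≠ 0) :
    ∃ y ∈ DZA, ∃ y' : torusFinAway' W S, (y, y') ∈ suppSetAway W S γ₀ 1 γ₀ := by
  by_contra h
  have h' : ∀ y ∈ DZA, ∀ y' : torusFinAway' W S, (y, y') ∉ suppSetAway W S γ₀ 1 γ₀ :=
    fun y hy y' hm => h ⟨y, hy, y', hm⟩
  apply haway
  unfold awayOrbital
  refine setIntegral_eq_zero_of_forall_eq_zero fun y hy => ?_
  have hin : (∫ y' : torusFinAway' W S, conj (R.chi' ((y' : torusFin' W) : torusT' W)) *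
      levelDCAway W S γ₀ 1 ((((y : torusFin W) : torusT W) : GA W)⁻¹ * GA.ofFinPart W γ₀ *
        (((y' : torusFin' W) : torusT' W) : GA W)) ∂νA') = 0 := by
    refine integral_eq_zero_of_ae (Filter.Eventually.of_forall fun y' => ?_)
    dsimp only
    rw [levelDCAway_pureArg_eq_indicator, Set.indicator_of_notMem (h' y hy y'), mul_zero]
    rfl
  rw [hin, mul_zero]

end Away

/-! ## 4. The phase-integral bound -/

section Phase

variable {k : Type} [Field k] [NumberField k] (W : PlaneData k) (S : Set (HeightOneSpectrum (𝓞 k)))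
  [MeasurableSpace (GA W)] (R : RTFData W)

/-- The `S`-part phase `(x, x′) ↦ χ(x) conj χ′(x′)` on `T_S × T′_S` is continuous. -/
theorem continuous_phaseAt (hc : Continuous R.chi) (hc' : Continuous R.chi') :
    Continuous (fun q : torusFinAt W S × torusFinAt' W S =>
      R.chi ((q.1 : torusFin W) : torusT W) * conj (R.chi' ((q.2 : torusFin' W) : torusT' W))) :=
  (hc.comp (continuous_subtype_val.comp (continuous_subtype_val.comp continuous_fst))).mul
    (Complex.continuous_conj.comp
      (hc'.comp (continuous_subtype_val.comp (continuous_subtype_val.comp continuous_snd))))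

/-- The `S`-part phase is unimodular. -/
theorem norm_phaseAt (hu : ∀ a, ‖R.chi a‖ = 1) (hu' : ∀ a, ‖R.chi' a‖ = 1) (q : torusFinAt W S × torusFinAt' W S) :
    ‖R.chi ((q.1 : torusFin W) : torusT W) * conj (R.chi' ((q.2 : torusFin' W) : torusT' W))‖ = 1 := by
  rw [norm_mul, Complex.norm_conj, hu, hu', one_mul]

/-- **The `S`-part phase of a pair whose `S`-parts are `(t, t′)` is `χ(t) conj χ′(t′)`.** -/
theorem pPhase_eq_of_ofPlacesPart (q : torusFin W × torusFin' W) (t : torusT W) (t' : torusT' W)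
    (h1 : GA.ofPlacesPart W S ((q.1 : torusT W) : GA W) = (t : GA W))
    (h2 : GA.ofPlacesPart W S ((q.2 : torusT' W) : GA W) = (t' : GA W)) :
    pPhase W R S q = R.chi t * conj (R.chi' t') := by
  unfold pPhase
  have e1 : (⟨GA.ofPlacesPart W S ((q.1 : torusT W) : GA W), ofPlacesPart_mem_torusT W S (q.1 : torusT W).2⟩ :
      torusT W) = t := Subtype.ext h1
  have e2 : (⟨GA.ofPlacesPart W S ((q.2 : torusT' W) : GA W), ofPlacesPart_mem_torusT' W S (q.2 : torusT' W).2⟩ :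
      torusT' W) = t' := Subtype.ext h2
  rw [e1, e2]

variable [BorelSpace (GA W)] (γ₀ : GA W) (N : ℕ) (νS : Measure (torusFinAt W S)) (νS' : Measure (torusFinAt' W S))

/-- **`localFactorAt` is ONE integral of the phase over the `DZ_S`-cut `S`-support set** with respect to the product
measure `ν_S ⊗ ν′_S` (Fubini on a bounded integrand of finite support measure). -/
theorem localFactorAt_eq_setIntegral [νS.IsHaarMeasure] [νS'.IsHaarMeasure]
    (hc : Continuous R.chi) (hu : ∀ a, ‖R.chi a‖ = 1) (hc' : Continuous R.chi') (hu' : ∀ a, ‖R.chi' a‖ = 1)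
    (hN : N ≠ 0) (DZS : Set (torusFinAt W S)) (hfin : suppMeasureAt W S γ₀ N γ₀ νS νS' DZS ≠ ⊤) :
    localFactorAt W S R γ₀ N νS νS' DZS =
      ∫ q in suppSetAt W S γ₀ N γ₀ ∩ DZS ×ˢ Set.univ,
        R.chi ((q.1 : torusFin W) : torusT W) * conj (R.chi' ((q.2 : torusFin' W) : torusT' W)) ∂(νS.prod νS') := by
  haveI : BorelSpace (torusT W) := Subtype.borelSpace _
  haveI : BorelSpace (torusT' W) := Subtype.borelSpace _
  haveI : BorelSpace (torusFin W) := Subtype.borelSpace _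
  haveI : BorelSpace (torusFin' W) := Subtype.borelSpace _
  haveI : BorelSpace (torusFinAt W S) := Subtype.borelSpace _
  haveI : BorelSpace (torusFinAt' W S) := Subtype.borelSpace _
  haveI : LocallyCompactSpace (torusFinAt W S) := locallyCompact_torusFinAt W S
  haveI : LocallyCompactSpace (torusFinAt' W S) := locallyCompact_torusFinAt' W S
  haveI : SecondCountableTopology (torusFinAt W S) := secondCountable_torusFinAt W S
  haveI : SecondCountableTopology (torusFinAt' W S) := secondCountable_torusFinAt' W S
  haveI : IsLocallyFiniteMeasure νS := isLocallyFiniteMeasure_of_isFiniteMeasureOnCompacts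
  haveI : SigmaFinite νS := sigmaFinite_of_locallyFinite
  haveI : IsLocallyFiniteMeasure νS' := isLocallyFiniteMeasure_of_isFiniteMeasureOnCompacts
  haveI : SigmaFinite νS' := sigmaFinite_of_locallyFinite
  have hAt : MeasurableSet (suppSetAt W S γ₀ N γ₀) := (isClosed_suppSetAt W S γ₀ N γ₀ hN).measurableSet
  -- the phase is integrable on the cut support set (bounded by `1`, finite measure)
  have hφ : IntegrableOn (fun q : torusFinAt W S × torusFinAt' W S =>
        R.chi ((q.1 : torusFin W) : torusT W) * conj (R.chi' ((q.2 : torusFin' W) : torusT' W)))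
      (suppSetAt W S γ₀ N γ₀ ∩ DZS ×ˢ Set.univ) (νS.prod νS') :=
    Measure.integrableOn_of_bounded hfin (continuous_phaseAt W S R hc hc').aestronglyMeasurable
      (Filter.Eventually.of_forall fun q => (norm_phaseAt W S R hu hu' q).le)
  -- the pointwise shape of the inner integrand
  have hpt : ∀ (x : torusFinAt W S) (x' : torusFinAt' W S),
      R.chi ((x : torusFin W) : torusT W) * (conj (R.chi' ((x' : torusFin' W) : torusT' W)) *
        levelDCAt W S γ₀ N ((((x : torusFin W) : torusT W) : GA W)⁻¹ * GA.ofFinPart W γ₀ *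
          (((x' : torusFin' W) : torusT' W) : GA W))) =
      (suppSetAt W S γ₀ N γ₀).indicator (fun q : torusFinAt W S × torusFinAt' W S =>
        R.chi ((q.1 : torusFin W) : torusT W) * conj (R.chi' ((q.2 : torusFin' W) : torusT' W))) (x, x') := by
    intro x x'
    rw [levelDCAt_pureArg_eq_indicator]
    by_cases h : (x, x') ∈ suppSetAt W S γ₀ N γ₀
    · rw [Set.indicator_of_mem h, Set.indicator_of_mem h, mul_one]
    · rw [Set.indicator_of_notMem h, Set.indicator_of_notMem h, mul_zero, mul_zero]
  -- the product measure restricted to `DZS × T′_S`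
  have hprod : (νS.restrict DZS).prod νS' = (νS.prod νS').restrict (DZS ×ˢ Set.univ) := by
    rw [← Measure.prod_restrict, Measure.restrict_univ]
  have hint : Integrable ((suppSetAt W S γ₀ N γ₀).indicator (fun q : torusFinAt W S × torusFinAt' W S =>
        R.chi ((q.1 : torusFin W) : torusT W) * conj (R.chi' ((q.2 : torusFin' W) : torusT' W))))
      ((νS.restrict DZS).prod νS') := by
    rw [hprod]
    exact (integrableOn_indicator_iff hAt).2 hφ
  unfold localFactorAt
  have h1 : ∀ x : torusFinAt W S,
      R.chi ((x : torusFin W) : torusT W) * ∫ x', conj (R.chi' ((x' : torusFin' W) : torusT' W)) *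
        levelDCAt W S γ₀ N ((((x : torusFin W) : torusT W) : GA W)⁻¹ * GA.ofFinPart W γ₀ *
          (((x' : torusFin' W) : torusT' W) : GA W)) ∂νS' =
      ∫ x', (suppSetAt W S γ₀ N γ₀).indicator (fun q : torusFinAt W S × torusFinAt' W S =>
        R.chi ((q.1 : torusFin W) : torusT W) * conj (R.chi' ((q.2 : torusFin' W) : torusT' W))) (x, x') ∂νS' := by
    intro x
    rw [← integral_const_mul]
    exact integral_congr_ae (Filter.Eventually.of_forall fun x' => hpt x x')
  simp_rw [h1]
  rw [← integral_prod _ hint, hprod, integral_indicator hAt, Measure.restrict_restrict hAt]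

/-- **THE PHASE-INTEGRAL BOUND**: if the `S`-part phase is `ε`-close to `1` on the `DZ_S`-cut level fibre, then
`‖I_S(N) − vol_S(N)‖ ≤ ε · vol_S(N)`. -/
theorem norm_localFactorAt_sub_le [νS.IsHaarMeasure] [νS'.IsHaarMeasure]
    (hc : Continuous R.chi) (hu : ∀ a, ‖R.chi a‖ = 1) (hc' : Continuous R.chi') (hu' : ∀ a, ‖R.chi' a‖ = 1)
    (hN : N ≠ 0) (DZS : Set (torusFinAt W S)) (hfin : suppMeasureAt W S γ₀ N γ₀ νS νS' DZS ≠ ⊤) {ε : ℝ}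
    (hphase : ∀ x ∈ DZS, ∀ x' : torusFinAt' W S, (x, x') ∈ suppSetAt W S γ₀ N γ₀ →
      ‖R.chi ((x : torusFin W) : torusT W) * conj (R.chi' ((x' : torusFin' W) : torusT' W)) - 1‖ ≤ ε) :
    ‖localFactorAt W S R γ₀ N νS νS' DZS - ((suppMeasureAt W S γ₀ N γ₀ νS νS' DZS).toReal : ℂ)‖ ≤
      ε * (suppMeasureAt W S γ₀ N γ₀ νS νS' DZS).toReal := by
  haveI : BorelSpace (torusT W) := Subtype.borelSpace _
  haveI : BorelSpace (torusT' W) := Subtype.borelSpace _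
  haveI : BorelSpace (torusFin W) := Subtype.borelSpace _
  haveI : BorelSpace (torusFin' W) := Subtype.borelSpace _
  haveI : BorelSpace (torusFinAt W S) := Subtype.borelSpace _
  haveI : BorelSpace (torusFinAt' W S) := Subtype.borelSpace _
  haveI : SecondCountableTopology (torusFinAt W S) := secondCountable_torusFinAt W S
  haveI : SecondCountableTopology (torusFinAt' W S) := secondCountable_torusFinAt' W S
  have hfinA : (νS.prod νS') (suppSetAt W S γ₀ N γ₀ ∩ DZS ×ˢ Set.univ) ≠ ⊤ := hfin
  haveI : IsFiniteMeasure ((νS.prod νS').restrict (suppSetAt W S γ₀ N γ₀ ∩ DZS ×ˢ Set.univ)) :=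
    isFiniteMeasure_restrict.2 hfinA
  have hφ : IntegrableOn (fun q : torusFinAt W S × torusFinAt' W S =>
        R.chi ((q.1 : torusFin W) : torusT W) * conj (R.chi' ((q.2 : torusFin' W) : torusT' W)))
      (suppSetAt W S γ₀ N γ₀ ∩ DZS ×ˢ Set.univ) (νS.prod νS') :=
    Measure.integrableOn_of_bounded hfinA (continuous_phaseAt W S R hc hc').aestronglyMeasurable
      (Filter.Eventually.of_forall fun q => (norm_phaseAt W S R hu hu' q).le)
  have hconst : ((suppMeasureAt W S γ₀ N γ₀ νS νS' DZS).toReal : ℂ) =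
      ∫ _ in suppSetAt W S γ₀ N γ₀ ∩ DZS ×ˢ Set.univ, (1 : ℂ) ∂(νS.prod νS') := by
    rw [setIntegral_const, measureReal_def, Complex.real_smul, mul_one]
    rfl
  rw [localFactorAt_eq_setIntegral W S R γ₀ N νS νS' hc hu hc' hu' hN DZS hfin, hconst,
    ← integral_sub hφ (integrable_const (1 : ℂ))]
  refine le_trans (norm_setIntegral_le_of_norm_le_const (C := ε) hfinA.lt_top fun q hq => ?_) ?_
  · exact hphase q.1 hq.2.1 q.2 hq.1
  · rw [measureReal_def]
    exact le_rfl

/-- **The lower bound**: `(1 − ε) · vol_S(N) ≤ ‖I_S(N)‖` under the same phase closeness. -/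
theorem norm_localFactorAt_ge [νS.IsHaarMeasure] [νS'.IsHaarMeasure]
    (hc : Continuous R.chi) (hu : ∀ a, ‖R.chi a‖ = 1) (hc' : Continuous R.chi') (hu' : ∀ a, ‖R.chi' a‖ = 1)
    (hN : N ≠ 0) (DZS : Set (torusFinAt W S)) (hfin : suppMeasureAt W S γ₀ N γ₀ νS νS' DZS ≠ ⊤) {ε : ℝ}
    (hphase : ∀ x ∈ DZS, ∀ x' : torusFinAt' W S, (x, x') ∈ suppSetAt W S γ₀ N γ₀ →
      ‖R.chi ((x : torusFin W) : torusT W) * conj (R.chi' ((x' : torusFin' W) : torusT' W)) - 1‖ ≤ ε) :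
    (1 - ε) * (suppMeasureAt W S γ₀ N γ₀ νS νS' DZS).toReal ≤ ‖localFactorAt W S R γ₀ N νS νS' DZS‖ := by
  have h := norm_localFactorAt_sub_le W S R γ₀ N νS νS' hc hu hc' hu' hN DZS hfin hphase
  have hm : 0 ≤ (suppMeasureAt W S γ₀ N γ₀ νS νS' DZS).toReal := ENNReal.toReal_nonneg
  have h2 : ‖((suppMeasureAt W S γ₀ N γ₀ νS νS' DZS).toReal : ℂ)‖ - ‖localFactorAt W S R γ₀ N νS νS' DZS‖ ≤
      ‖((suppMeasureAt W S γ₀ N γ₀ νS νS' DZS).toReal : ℂ) - localFactorAt W S R γ₀ N νS νS' DZS‖ :=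
    norm_sub_norm_le _ _
  rw [norm_sub_rev, Complex.norm_real, Real.norm_of_nonneg hm] at h2
  linarith

end Phase

end Summit.Ventures.HodgeRepro.Tier4.Line4

end
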